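import Literature.Barriers.QuantumFields.GoldstoneTheorem
import HarnessLib

/-!
# Product test functions `g ⊗ f` on `ℝ^{1+3}` (support file for the KRS Goldstone theorem)

Support file for the discharge of the named fact `Literature.Barriers.QuantumFields.KRSLemmaIV`
(barrier catalogue `Literature/Barriers/QuantumFields/`, file `GoldstoneTheorem`): elementary
calculus of the test functions `(g ⊗ f)(x) = g(x⃗) f(x⁰)` of Kastler–Robinson–Swieca's classes
`𝒟_R ⊗ 𝒟_d` — existence as Schwartz functions from smooth compactly supported factors
(`exists_schwartz_tensor`), supports (`tsupport_tensor_subset`, `hasCompactSupport_tensor`), the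
directional derivatives `∂₀ (g ⊗ φ) = g ⊗ φ'`, `∂ᵢ (g ⊗ φ) = (∂ᵢ g) ⊗ φ`
(`lineDerivOp_zero_tensor`, `lineDerivOp_succ_tensor`, with Mathlib's `LineDeriv` notation on
`SchwartzMap`), commutation of `∂_v` with complex conjugation (`lineDerivOp_starTest`), and the
compactly supported primitive of a mean-zero bump used in KRS (13)-(14)
(`exists_smooth_primitive`). All folklore; no new definitions.

## References

[KastlerRobinsonSwieca1966] §III (13)-(14) (the primitive `f(x⁰) = ∫_{-∞}^{x⁰} (f_{d₁} - f_{d₂})`).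
-/

noncomputable section

open Filter Topology ComplexConjugate MeasureTheory Set
open scoped InnerProductSpace SchwartzMap LineDeriv ContDiff

namespace Literature.Barriers.QuantumFields

open Literature.MathematicalPhysics.QuantumLattice

/-! ### Existence and supports -/

/-- Smooth compactly supported `g` on `ℝ³` and `f` on `ℝ` give the Schwartz test function
`(g ⊗ f)(x) = g(x⃗) f(x⁰)` on `ℝ^{1+3}`. [folklore] -/
theorem exists_schwartz_tensor {g : EuclideanSpace ℝ (Fin 3) → ℂ} {f : ℝ → ℂ}
    (hg : ContDiff ℝ ∞ g) (hgs : HasCompactSupport g) (hf : ContDiff ℝ ∞ f)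
    (hfs : HasCompactSupport f) :
    ∃ Θ : 𝓢(SpaceTime 3, ℂ), ∀ x, Θ x = g (spaceC 3 x) * f (x 0) := by
  have hsmooth : ContDiff ℝ ∞ (fun x : SpaceTime 3 => g (spaceC 3 x) * f (x 0)) :=
    (hg.comp (spaceC 3).contDiff).mul
      (hf.comp (EuclideanSpace.proj (𝕜 := ℝ) (0 : Fin 4)).contDiff)
  have hcpt : HasCompactSupport (fun x : SpaceTime 3 => g (spaceC 3 x) * f (x 0)) := by
    let K : Set (SpaceTime 3) := (fun p : ℝ × EuclideanSpace ℝ (Fin 3) => ofTimeSpace p.1 p.2) ''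
      (tsupport f ×ˢ tsupport g)
    have hK : IsCompact K := (hfs.prod hgs).image continuous_ofTimeSpace
    refine HasCompactSupport.intro hK fun x hx => ?_
    by_contra hne
    rcases mul_ne_zero_iff.mp hne with ⟨h1, h2⟩
    apply hx
    exact ⟨(x 0, spaceC 3 x), ⟨subset_tsupport _ h2, subset_tsupport _ h1⟩,
      ofTimeSpace_apply_zero_spaceC x⟩
  exact ⟨hcpt.toSchwartzMap hsmooth, fun x => rfl⟩

/-- If `g` vanishes on the open ball `|y| < R` and `f` vanishes for `|t| > δ` then `g ⊗ f` is
supported in the shell region `{|x⃗| ≥ R, |x⁰| ≤ δ}`. [folklore] -/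
theorem tsupport_tensor_subset {Θ : 𝓢(SpaceTime 3, ℂ)} {g : EuclideanSpace ℝ (Fin 3) → ℂ}
    {f : ℝ → ℂ} (hΘ : ∀ x, Θ x = g (spaceC 3 x) * f (x 0)) {R δ : ℝ}
    (hg : ∀ y, ‖y‖ < R → g y = 0) (hf : ∀ t, δ < |t| → f t = 0) :
    tsupport (Θ : SpaceTime 3 → ℂ) ⊆ {x : SpaceTime 3 | R ≤ ‖spaceC 3 x‖ ∧ |x 0| ≤ δ} := by
  have hcl : IsClosed {x : SpaceTime 3 | R ≤ ‖spaceC 3 x‖ ∧ |x 0| ≤ δ} := by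
    refine IsClosed.inter (isClosed_le continuous_const (spaceC 3).continuous.norm) ?_
    exact isClosed_le (continuous_abs.comp (EuclideanSpace.proj (𝕜 := ℝ) (0 : Fin 4)).continuous)
      continuous_const
  refine closure_minimal (fun x hx => ?_) hcl
  rw [Function.mem_support, hΘ] at hx
  rcases mul_ne_zero_iff.mp hx with ⟨h1, h2⟩
  constructor
  · by_contra h
    exact h1 (hg _ (lt_of_not_ge h))
  · by_contra h
    exact h2 (hf _ (lt_of_not_ge h))

/-- `g ⊗ f` has compact support when `g` and `f` have. [folklore] -/
theorem hasCompactSupport_tensor {Θ : 𝓢(SpaceTime 3, ℂ)} {g : EuclideanSpace ℝ (Fin 3) → ℂ}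
    {f : ℝ → ℂ} (hΘ : ∀ x, Θ x = g (spaceC 3 x) * f (x 0)) (hgs : HasCompactSupport g)
    (hfs : HasCompactSupport f) : HasCompactSupport (Θ : SpaceTime 3 → ℂ) := by
  let K : Set (SpaceTime 3) := (fun p : ℝ × EuclideanSpace ℝ (Fin 3) => ofTimeSpace p.1 p.2) ''
    (tsupport f ×ˢ tsupport g)
  have hK : IsCompact K := (hfs.prod hgs).image continuous_ofTimeSpace
  refine HasCompactSupport.intro hK fun x hx => ?_
  by_contra hne
  rw [hΘ] at hne
  rcases mul_ne_zero_iff.mp hne with ⟨h1, h2⟩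
  apply hx
  exact ⟨(x 0, spaceC 3 x), ⟨subset_tsupport _ h2, subset_tsupport _ h1⟩,
    ofTimeSpace_apply_zero_spaceC x⟩

/-- A function with `tsupport f ⊆ [-δ, δ]` vanishes at every `t` with `|t| > δ`. [folklore] -/
theorem eq_zero_of_tsupport_subset_Icc {f : ℝ → ℂ} {δ : ℝ} (hf : tsupport f ⊆ Icc (-δ) δ)
    {t : ℝ} (ht : δ < |t|) : f t = 0 := by
  apply image_eq_zero_of_notMem_tsupport
  intro h
  have := hf h
  rw [mem_Icc, ← abs_le] at this
  linarith

/-! ### Directional derivatives -/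

/-- The time unit vector `e₀ = single 0 1` has zero spatial part. [folklore] -/
theorem spaceC_single_zero : spaceC 3 (EuclideanSpace.single (0 : Fin 4) (1 : ℝ)) = 0 := by
  ext i
  simp [spaceC_apply, Fin.succ_ne_zero]

/-- The spatial part of the unit vector `e_{i+1}` of `ℝ^{1+3}` is the unit vector `eᵢ` of `ℝ³`.
[folklore] -/
theorem spaceC_single_succ (i : Fin 3) :
    spaceC 3 (EuclideanSpace.single i.succ (1 : ℝ)) = EuclideanSpace.single i 1 := by
  ext j
  simp [spaceC_apply, Fin.succ_inj]

/-- Directional derivatives commute with complex conjugation of test functions: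
`∂_v f̄ = (∂_v f)‾` (`v` a real direction). [folklore] -/
theorem lineDerivOp_starTest (v : SpaceTime 3) (F : 𝓢(SpaceTime 3, ℂ)) :
    ∂_{v} (starTest F) = starTest (∂_{v} F) := by
  ext x
  rw [SchwartzMap.lineDerivOp_apply_eq_fderiv, starTest_apply,
    SchwartzMap.lineDerivOp_apply_eq_fderiv]
  have hcoe : ((starTest F : 𝓢(SpaceTime 3, ℂ)) : SpaceTime 3 → ℂ) =
      (Complex.conjCLE : ℂ →L[ℝ] ℂ) ∘ (F : SpaceTime 3 → ℂ) := by
    funext y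
    simp
  rw [hcoe, ((Complex.conjCLE : ℂ →L[ℝ] ℂ).hasFDerivAt.comp x (F.hasFDerivAt x)).fderiv]
  simp

/-- The Fréchet derivative of `x ↦ g(x⃗) φ(x⁰)` (product and chain rule). [folklore] -/
theorem hasFDerivAt_tensor {g : EuclideanSpace ℝ (Fin 3) → ℂ} {φ u : ℝ → ℂ}
    (hg : Differentiable ℝ g) (hφ : ∀ s, HasDerivAt φ (u s) s) (x : SpaceTime 3) :
    HasFDerivAt (fun y : SpaceTime 3 => g (spaceC 3 y) * φ (y 0))
      (g (spaceC 3 x) • ((ContinuousLinearMap.smulRight (1 : ℝ →L[ℝ] ℝ) (u (x 0))).comp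
          (EuclideanSpace.proj (0 : Fin 4))) +
        φ (x 0) • ((fderiv ℝ g (spaceC 3 x)).comp (spaceC 3 : SpaceTime 3 →L[ℝ] _))) x := by
  have h1 : HasFDerivAt (fun y : SpaceTime 3 => g (spaceC 3 y))
      ((fderiv ℝ g (spaceC 3 x)).comp (spaceC 3 : SpaceTime 3 →L[ℝ] _)) x :=
    (hg _).hasFDerivAt.comp x (spaceC 3).hasFDerivAt
  have h2 : HasFDerivAt (fun y : SpaceTime 3 => φ (y 0))
      ((ContinuousLinearMap.smulRight (1 : ℝ →L[ℝ] ℝ) (u (x 0))).comp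
        (EuclideanSpace.proj (0 : Fin 4))) x :=
    (hφ (x 0)).hasFDerivAt.comp x (EuclideanSpace.proj (𝕜 := ℝ) (0 : Fin 4)).hasFDerivAt
  exact h1.mul h2

/-- **Time derivative of a product test function**: `∂₀ (g ⊗ φ) = g ⊗ φ'`. [folklore] -/
theorem lineDerivOp_zero_tensor {Θ Υ : 𝓢(SpaceTime 3, ℂ)} {g : EuclideanSpace ℝ (Fin 3) → ℂ}
    {φ u : ℝ → ℂ} (hg : Differentiable ℝ g) (hφ : ∀ s, HasDerivAt φ (u s) s)
    (hΘ : ∀ x, Θ x = g (spaceC 3 x) * φ (x 0)) (hΥ : ∀ x, Υ x = g (spaceC 3 x) * u (x 0)) :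
    ∂_{(EuclideanSpace.single (0 : Fin 4) (1 : ℝ) : SpaceTime 3)} Θ = Υ := by
  ext x
  rw [SchwartzMap.lineDerivOp_apply_eq_fderiv, hΥ]
  have hcoe : (Θ : SpaceTime 3 → ℂ) = fun y => g (spaceC 3 y) * φ (y 0) := funext hΘ
  rw [hcoe, (hasFDerivAt_tensor hg hφ x).fderiv]
  simp [spaceC_single_zero]

/-- **Space derivatives of a product test function**: `∂ᵢ (g ⊗ φ) = (∂ᵢ g) ⊗ φ`, `i = 1, 2, 3`.
[folklore] -/
theorem lineDerivOp_succ_tensor {Θ Ξ : 𝓢(SpaceTime 3, ℂ)} {g : EuclideanSpace ℝ (Fin 3) → ℂ}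
    {φ u : ℝ → ℂ} (hg : Differentiable ℝ g) (hφ : ∀ s, HasDerivAt φ (u s) s)
    (hΘ : ∀ x, Θ x = g (spaceC 3 x) * φ (x 0)) (i : Fin 3)
    (hΞ : ∀ x, Ξ x = fderiv ℝ g (spaceC 3 x) (EuclideanSpace.single i 1) * φ (x 0)) :
    ∂_{(EuclideanSpace.single i.succ (1 : ℝ) : SpaceTime 3)} Θ = Ξ := by
  ext x
  rw [SchwartzMap.lineDerivOp_apply_eq_fderiv, hΞ]
  have hcoe : (Θ : SpaceTime 3 → ℂ) = fun y => g (spaceC 3 y) * φ (y 0) := funext hΘ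
  rw [hcoe, (hasFDerivAt_tensor hg hφ x).fderiv]
  simp [spaceC_single_succ, Fin.succ_ne_zero, mul_comm]

/-! ### The primitive of a mean-zero bump -/

/-- **The primitive of a mean-zero bump** (KRS (13)-(14)): if `u` is smooth, vanishes for
`|t| > δ` and has `∫ u = 0`, then `φ(s) = ∫_{-∞}^{s} u` is smooth with `φ' = u` and vanishes for
`|s| ≥ δ₁`, any `δ₁ > δ`. [cite: KastlerRobinsonSwieca1966, §III (13)-(14)] -/
theorem exists_smooth_primitive {u : ℝ → ℂ} (hu : ContDiff ℝ ∞ u) {δ δ₁ : ℝ} (hδ : δ < δ₁)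
    (hsupp : ∀ t, δ < |t| → u t = 0) (hint : ∫ t, u t = 0) :
    ∃ φ : ℝ → ℂ, ContDiff ℝ ∞ φ ∧ (∀ s, HasDerivAt φ (u s) s) ∧
      ∀ s, δ₁ ≤ |s| → φ s = 0 := by
  have huc : Continuous u := hu.continuous
  set φ : ℝ → ℂ := fun s => ∫ t in (-δ₁)..s, u t with hφ
  have hderiv : ∀ s, HasDerivAt φ (u s) s := fun s =>
    intervalIntegral.integral_hasDerivAt_right (huc.intervalIntegrable _ _)
      (huc.stronglyMeasurableAtFilter _ _) huc.continuousAt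
  have hdiff : Differentiable ℝ φ := fun s => (hderiv s).differentiableAt
  have hderiv' : deriv φ = u := funext fun s => (hderiv s).deriv
  refine ⟨φ, ?_, hderiv, fun s hs => ?_⟩
  · rw [contDiff_infty_iff_deriv, hderiv']
    exact ⟨hdiff, hu⟩
  · rcases le_abs'.mp hs with hs | hs
    · -- `s ≤ -δ₁`: the integrand vanishes on `[s, -δ₁]`
      have hzero : EqOn u (fun _ => (0 : ℂ)) (uIcc (-δ₁) s) := by
        intro t ht
        rw [uIcc_of_ge hs, mem_Icc] at ht
        apply hsupp
        rw [lt_abs]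
        right
        linarith
      simp only [hφ]
      rw [intervalIntegral.integral_congr hzero, intervalIntegral.integral_zero]
    · -- `δ₁ ≤ s`: the integral is the total integral, which vanishes
      have hsub : Function.support u ⊆ Ioc (-δ₁) s := by
        intro t ht
        rw [Function.mem_support] at ht
        have h1 : |t| ≤ δ := by
          by_contra h
          exact ht (hsupp t (lt_of_not_ge h))
        rw [abs_le] at h1
        constructor <;> linarith [h1.1, h1.2]
      simp only [hφ]
      rw [intervalIntegral.integral_eq_integral_of_support_subset hsub, hint]

end Literature.Barriers.QuantumFields
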